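import Summits.HodgeConjecture.HodgeConjecture.Theorems.HodgeLocusCensusSchema
import Summits.HodgeConjecture.HodgeConjecture.Theorems.HodgeLocusCensusSecondComponents
import HarnessLib
import HarnessLib.Audit.Tags

/-!
# HodgeLocusCensusConeLaw — the quartic (K3-landing) cone-curve tangent certificates (cell pub-hlocus, referee gen 13, REFEREE.md R27)
HONEST FRAMING: certified instances and evidence bearing on the general Hodge conjecture; no claim.

The lead's UNIFIED CONE LAW (COMPONENTS 2026-08-19T21:10Z, countersigned R27): for d = 4 the Shioda-sum 2-plane
Σ = {F + a·g₁ + b·g₀} with g₁ = x_b x_{b+1}x_{b+2}x_{b+3} + x_b²x_{b+2}x_{b+3}, g₀ = x_{b+1}²x_{b+2}x_{b+3} + x_b x_{b+1}x_{b+3}²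
(b = n − 2, the last four variables) lands on the quartic K3 surface S_{a,b} = V(x_b⁴ + … + x_{b+3}⁴ + a g₁ + b g₀) (h^{2,0} = 1),
and V_{[P]+λ[P̌]} ∩ Σ is the Noether–Lefschetz curve of [N₁] + λ[N₂] on S_{a,b}, N₁, N₂ the two lines of the Fermat quartic surface
under the standard pair (meeting iff the last slot is shared). What is PROVED here (kernel, no sorry) is the first-order datum of R27 (b):
the 2 × 2 matrix of first-order periods along (g₀, g₁) at the surviving row index has NONZERO determinant over ℚ(ζ₈) — for the K3 itself
(n = 2, row index 0, both landings) and for the coned cells (4,4,1) / (4,4,0) at the row x₀² (one of the (d−1)^j = 3 surviving components).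
Consequence (cited, not formalised): the linear part of the single Hodge equation on Σ is nonzero for EVERY λ, the curve is smooth and not
contained in V_{[P]} (λ ≠ 0) nor in V_{[P̌]}. The cone identification, the (d−1)^j component count, HC along the trace (Lefschetz (1,1)
on the K3 + the join correspondence) and the open status of the general point are the cited evidence (COMPONENTS / REFEREE R27), not Props.
Cross-check: the determinants agree (up to the overall sign of the normalisation) with engine R's mod-p series linear parts
(data/ivhs/census/refg13/, REFEREE R27 (b)). Counting lemmas are `decide`.
-/
namespace Summit.HodgeConjecture.HodgeConjecture.HodgeLocus.Census

/-- ζ a primitive 8th root of unity in a field of characteristic zero: ζ⁸ = 1, ζ⁴ = −1, ζ ≠ 1, ζ ≠ −1, ζ ≠ 0. -/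
theorem primRoot8_facts {K : Type} [Field K] [CharZero K] (ζ : K) (hζ : IsPrimitiveRoot ζ (2*4)) :
    ζ ^ 8 = 1 ∧ ζ ^ 4 = -1 ∧ ζ ≠ 1 ∧ ζ ≠ -1 ∧ ζ ≠ 0 := by
  have h8 : ζ ^ 8 = 1 := hζ.pow_eq_one
  have h4 : ζ ^ 4 = -1 := by
    have hp : IsPrimitiveRoot (ζ ^ 4) 2 := hζ.pow (by norm_num) (by norm_num)
    exact hp.eq_neg_one_of_two_right
  have hne1 : ζ ≠ 1 := by
    intro h; have := hζ.pow_ne_one_of_pos_of_lt (by norm_num : (1:ℕ) ≠ 0) (by norm_num : 1 < 2*4)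
    apply this; rw [h]; norm_num
  have hnem1 : ζ ≠ -1 := by
    intro h; have := hζ.pow_ne_one_of_pos_of_lt (by norm_num : (2:ℕ) ≠ 0) (by norm_num : 2 < 2*4)
    apply this; rw [h]; norm_num
  have hne0 : ζ ≠ 0 := hζ.ne_zero (by norm_num)
  exact ⟨h8, h4, hne1, hnem1, hne0⟩

/-- the second line of the Fermat quartic surface SKEW to the standard line (twist on both odd positions; m = −1 in engine notation) -/
def skewLine : LinearCycle 2 := ⟨fun e => if e.1 % 2 = 1 then 1 else 0, 1⟩

/-- K3 landing, MEETING lines (shared slot (x₀,x₁)): Σ = {x₀⁴+x₁⁴+x₂⁴+x₃⁴ + a·(x₀x₁x₂x₃ + x₀²x₂x₃) + b·(x₁²x₂x₃ + x₀x₁x₃²)}, row index 0.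
PROVED: p(N₁;g₀) = 2ζ³, p(N₁;g₁) = ζ⁴+ζ⁵, p(N₂;g₀) = ζ⁷+ζ⁵, p(N₂;g₁) = ζ⁸+ζ⁹; determinant = −ζ(1+ζ)²(1−ζ) ≠ 0 (ζ⁴ = −1). -/
theorem coneTangent_K3_meeting :
  ConeTangentCert 2 4 (standardP 2) (standardPc 2 0 1)
    [![0,2,1,1], ![1,1,0,2]] [![1,1,1,1], ![2,0,1,1]] (fun _ => 0) := by
  intro K _ _ ζ hζ
  simp only [firstOrderAlong, periodComb, period, standardP, standardPc, List.map_cons, List.map_nil, List.sum_cons, List.sum_nil]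
  simp [Fin.forall_fin_succ, Fin.sum_univ_succ]
  obtain ⟨h8, h4, hne1, hnem1, hne0⟩ := primRoot8_facts ζ hζ
  intro h
  have h5 : ζ ^ 5 = -ζ := by linear_combination ζ * h4
  have h7 : ζ ^ 7 = -(ζ ^ 3) := by linear_combination ζ ^ 3 * h4
  have h9 : ζ ^ 9 = ζ := by linear_combination ζ * h8
  rw [h5, h7, h8, h9, h4] at h
  -- h : polynomial identity in ζ of degree ≤ 3 ⇒ (1+ζ)²(1−ζ)ζ = 0 after ζ⁴ = −1
  have hf : ζ * (1 + ζ) ^ 2 * (1 - ζ) = 0 := by linear_combination (-1 : K) * h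
  rcases mul_eq_zero.1 hf with h' | h'
  · rcases mul_eq_zero.1 h' with h'' | h''
    · exact hne0 h''
    · exact hnem1 (by have := pow_eq_zero_iff (n := 2) (by norm_num) |>.1 h''; linear_combination this)
  · exact hne1 (by linear_combination -h')

/-- K3 landing, SKEW lines: same Σ, N₂ = skewLine, row index 0.
PROVED: p(N₂;g₀) = 2ζ⁹, p(N₂;g₁) = ζ¹²+ζ¹⁵; determinant = 2ζ + 4ζ² − 2ζ³ = 2ζ(1 + 2ζ − ζ²) ≠ 0 (ζ² = 1 + 2ζ would force ζ = −1/2, ζ⁸ ≠ 1). -/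
theorem coneTangent_K3_skew :
  ConeTangentCert 2 4 (standardP 2) skewLine
    [![0,2,1,1], ![1,1,0,2]] [![1,1,1,1], ![2,0,1,1]] (fun _ => 0) := by
  intro K _ _ ζ hζ
  simp only [firstOrderAlong, periodComb, period, standardP, skewLine, List.map_cons, List.map_nil, List.sum_cons, List.sum_nil]
  simp [Fin.forall_fin_succ, Fin.sum_univ_succ]
  obtain ⟨h8, h4, hne1, hnem1, hne0⟩ := primRoot8_facts ζ hζ
  intro h
  have h5 : ζ ^ 5 = -ζ := by linear_combination ζ * h4
  have h9 : ζ ^ 9 = ζ := by linear_combination ζ * h8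
  have h12 : ζ ^ 12 = -1 := by linear_combination ζ ^ 4 * h8 + h4
  have h15 : ζ ^ 15 = -(ζ ^ 3) := by linear_combination ζ ^ 7 * h8 + ζ ^ 3 * h4
  rw [h5, h9, h12, h15, h4] at h
  have hq : ζ ^ 2 = 1 + 2 * ζ := by
    have hf : ζ * (ζ ^ 2 - 1 - 2 * ζ) = 0 := by linear_combination (-1/2 : K) * h - ζ ^ 2 * h4
    rcases mul_eq_zero.1 hf with h' | h'
    · exact absurd h' hne0
    · linear_combination h'
  have hz : ζ = -1/2 := by
    have : ζ ^ 4 = (1 + 2 * ζ) ^ 2 := by rw [show (4:ℕ) = 2 * 2 by norm_num, pow_mul, hq]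
    rw [h4] at this
    linear_combination (-1/12 : K) * this + (-1/3 : K) * hq
  rw [hz] at h8; norm_num at h8

/-- exponent vectors on ℙ⁵ (quartic fourfolds): the plane directions live in x₂..x₅, the row x₀² on the coned slot -/
def rowX0sq : Fin 6 → ℕ := fun e => if e = 0 then 2 else 0

/-- (4,4,1) tw1 (lines' cone: the pair shares slot (x₀,x₁); K3 landing = MEETING lines), row x₀² (one of the 3 = (d−1)^j surviving components).
PROVED: determinant = −(1 − ζ − ζ² − ζ³) ≠ 0 (ζ³ = 1 − ζ − ζ² would force ζ⁴ = 2ζ − 1 = −1, i.e. ζ = 0). -/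
theorem coneTangent_4_4_1_rowX0sq :
  ConeTangentCert 4 4 (standardP 4) (standardPc 4 1 1)
    [![0,0,0,2,1,1], ![0,0,1,1,0,2]] [![0,0,1,1,1,1], ![0,0,2,0,1,1]] rowX0sq := by
  intro K _ _ ζ hζ
  simp only [firstOrderAlong, periodComb, period, standardP, standardPc, rowX0sq, List.map_cons, List.map_nil, List.sum_cons, List.sum_nil]
  simp [Fin.forall_fin_succ, Fin.sum_univ_succ]
  obtain ⟨h8, h4, hne1, hnem1, hne0⟩ := primRoot8_facts ζ hζ
  intro h
  have h6 : ζ ^ 6 = -(ζ ^ 2) := by linear_combination ζ ^ 2 * h4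
  have h7 : ζ ^ 7 = -(ζ ^ 3) := by linear_combination ζ ^ 3 * h4
  have h10 : ζ ^ 10 = ζ ^ 2 := by linear_combination ζ ^ 2 * h8
  have h11 : ζ ^ 11 = ζ ^ 3 := by linear_combination ζ ^ 3 * h8
  have h12 : ζ ^ 12 = -1 := by linear_combination ζ ^ 4 * h8 + h4
  rw [h6, h7, h8, h10, h11, h12] at h
  have hc : ζ ^ 3 = 1 - ζ - ζ ^ 2 := by linear_combination h + ζ * h4
  have : ζ ^ 4 = 2 * ζ - 1 := by linear_combination (ζ - 1) * hc
  rw [h4] at this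
  exact hne0 (by linear_combination (-1/2 : K) * this)

/-- (4,4,0) tw1 (no shared slot; K3 landing = SKEW lines), row x₀².
PROVED: determinant = 2(2 − ζ − ζ³) ≠ 0 (ζ³ = 2 − ζ forces ζ² = 1 + 2ζ, then ζ = −1/2, ζ⁸ ≠ 1). -/
theorem coneTangent_4_4_0_rowX0sq :
  ConeTangentCert 4 4 (standardP 4) (standardPc 4 0 1)
    [![0,0,0,2,1,1], ![0,0,1,1,0,2]] [![0,0,1,1,1,1], ![0,0,2,0,1,1]] rowX0sq := by
  intro K _ _ ζ hζ
  simp only [firstOrderAlong, periodComb, period, standardP, standardPc, rowX0sq, List.map_cons, List.map_nil, List.sum_cons, List.sum_nil]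
  simp [Fin.forall_fin_succ, Fin.sum_univ_succ]
  obtain ⟨h8, h4, hne1, hnem1, hne0⟩ := primRoot8_facts ζ hζ
  intro h
  have h6 : ζ ^ 6 = -(ζ ^ 2) := by linear_combination ζ ^ 2 * h4
  have h7 : ζ ^ 7 = -(ζ ^ 3) := by linear_combination ζ ^ 3 * h4
  have h12 : ζ ^ 12 = -1 := by linear_combination ζ ^ 4 * h8 + h4
  have h15 : ζ ^ 15 = -(ζ ^ 3) := by linear_combination ζ ^ 7 * h8 + ζ ^ 3 * h4
  have h18 : ζ ^ 18 = ζ ^ 2 := by linear_combination ζ ^ 2 * (ζ ^ 8 + 1) * h8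
  rw [h6, h7, h8, h12, h15, h18] at h
  have hc : ζ ^ 3 = 2 - ζ := by linear_combination (-1/2 : K) * h + (ζ - 1) * h4
  have hq : ζ ^ 2 = 1 + 2 * ζ := by
    have : ζ ^ 4 = 2 * ζ - ζ ^ 2 := by linear_combination ζ * hc
    rw [h4] at this; linear_combination this
  have hz : ζ = -1/2 := by
    have : ζ ^ 4 = (1 + 2 * ζ) ^ 2 := by rw [show (4:ℕ) = 2 * 2 by norm_num, pow_mul, hq]
    rw [h4] at this
    linear_combination (-1/12 : K) * this + (-1/3 : K) * hq
  rw [hz] at h8; norm_num at h8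

/-- CONE-LAW BOOKKEEPING (R27 (e)): with k = n/2, c = k − m, j = (n − n_L)/2, n_L = 4 (d = 3) / 2 (d = 4):
`m + 1 ≥ j ⟺ (c − 1)(d − 2) ≤ 2` on every cell of the census grid with d ∈ {3,4}, n ≤ 14, 0 ≤ m < n/2. -/
theorem coneLaw_iff_excessCriterion :
    ∀ n ∈ [4, 6, 8, 10, 12, 14], ∀ d ∈ [3, 4], ∀ m < n / 2,
      (m + 1 ≥ (n - (if d = 3 then 4 else 2)) / 2) ↔ ((n / 2 - m - 1) * (d - 2) ≤ 2) := by decide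

/-- surviving components on the Shioda-sum plane: (d − 1)^j with j = (n − n_L)/2 — the counts engine R found (R27 (a)). -/
theorem coneLaw_componentCounts :
    3 ^ ((4 - 2) / 2) = 3 ∧ 3 ^ ((6 - 2) / 2) = 9 ∧ 3 ^ ((8 - 2) / 2) = 27 ∧
    2 ^ ((10 - 4) / 2) = 8 ∧ 2 ^ ((12 - 4) / 2) = 16 ∧ 2 ^ ((14 - 4) / 2) = 32 := by decide

end Summit.HodgeConjecture.HodgeConjecture.HodgeLocus.Census
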